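/-
Copyright: statement-level skeleton of a published paper (lit-balaban cell, Phase-2 proof seat p26 gen 40). No claims beyond
what the kernel checks below.
-/
import Mathlib
import Literature.MathematicalPhysics.QuantumFieldTheory.Balaban1983to89.B3GraphAmplitudeRules

/-!
# B3 — T. Bałaban, *(Higgs)₂,₃ quantum fields in a finite volume. III. Renormalization*, CMP **88** (1983) 411–445
[Balaban1983Higgs3] — pp. 419–421 [PDF 9–11]: **r15's carrier `B3Prop1.Expansion` (the data (1.33)/Proposition 1 speak about)
INSTANTIATED with the field `E` given by the Feynman-rule evaluator** — `E(G_ren, {□(v)}_{v∈G_ren}, Φ_ext, A_ext) := Σ_{G∈G_ren} c_G ·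
graphAmp G …` (FILE 1 `B3GraphAmplitude.amp` at FILE 2's catalogue rules `B3GraphAmplitudeRules.rulesOf`), with the printed orders
`d_s(G_ren)`, `d_v(G_ren)` tied to r15's `dsOf`/`dvOf`, and (1.33) for this instance unfolded to the printed inequality for the
evaluator's class sums (FILE 4 of the evaluator: the identification *"owed at B3.Prop1"*)

statement-level skeleton of published theorems with citation tags; proofs where landed; nothing here is a claim about
the Yang–Mills mass gap

PDF held: `paper:balaban1983-higgs-2-3-quantum-fields-finite-volume` (journal page = PDF page + 410); pp. 419–421, 424, 432 [PDF 9–11, 14,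
22] read on the ×2 renders `run/shared/lean/pub/pub-balaban/b2b-balaban-ref1/pages/1983-cmp88-higgs23-III/…-p009,p010,p011,p014,p022-x2.png`
(2026-08-23).

CITATION HEADER (lean-in-tree rule).  lit-balaban TYPED SKELETON (HOME `run/shared/lean/pub/lit-balaban/`), PHASE 2, seat p26 gen 40
(unit `lit-balaban-p26`); OWNER-NAMED target: the fold owner r15 g15's word to this seat 2026-08-23T11:06Z on the FILE-4 offer — *"YES,
WELCOME as FILE 4 — an `Expansion`-instance whose `E` field is the coefficient sum of `graphAmp`s over a class, with `dsOf/dvOf` and the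
(1.32) norms/tree length supplied, is exactly the identification member the Q26 clause names «owed at row B3.Prop1» … build the
instance in your file, do not edit mine"* (TAKING #5, HOME/STATUS.md 2026-08-23T11:35Z).  ROWS **B3.Prop1** (pp. 420–421; head
`typed p238938` = r15's `B3Prop1`, class (c), untouched — this file is a located identification member, cells only) and **B3.Def@420**
of `HOME/lit-balaban-r15/ROWS-B3.md`.  CONSUMES BY NAME, nothing re-declared or edited: r15's `B3Prop1.Expansion`, `Ineq133At`,
`dsOf`, `dvOf` (p238938), p18's `B3Cor23Concrete.Graph`, this seat's `B3GraphAmplitude` (p361338: `SLine/VLine/ExtSLeg/ExtVLeg`,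
`OutPairing`, `oRank`) and `B3GraphAmplitudeRules` (p362438: `Model`, `Loc`, `Loc.triv`, `Loc.IsPartitionFor`, `graphAmp`,
`graphAmp_partition_sum`).

THE PRINTED TEXT (verbatim).  p. 420 [PDF 10]: *"Let us denote by E(G, {□(v)}_{v∈G}, Φ_ext, A_ext) the expression corresponding to
graph G with localizations {□(v)}_{v∈G} and external fields Φ_ext, A_ext. The same symbol with G_ren instead of G denotes a sum of these
expressions for G ∈ G_ren. Let us denote by d_s(v) an order of the coupling constant λ for the vertex v, and by d_v(v) an order of the
coupling constant e. Finally let d_s(G) = Σ_{v∈G} d_s(v), d_v(G) = Σ_{v∈G} d_v(v). The numbers d_s(G), d_v(G) are well-defined for G_ren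
because all graphs in the family G_ren have the same orders. We have |E(G_ren, {□(v)}_{v∈G_ren}, Φ_ext, A_ext)| ≤
O(1)(e(L^kε))^{d_v(G_ren)}(λ(L^kε))^{d_s(G_ren)} exp[−δ₀d({□(v)}_{v∈G_ren})] · ‖hΦ_ext‖_{1,α₀}‖h′A_ext‖_{1,α₀}, (1.33) where
0 < α₀ < 1, d({□(v)}_{v∈G}) denotes a length of a shortest tree graph connecting the vertices v localized in □(v), v ∈ G, and the
functions h, h′ describes localizations of external fields."* (print's `≦` read as `≤`); p. 420: *"We gather some graphs into families
denoted G_ren. In the next chapter we will describe precisely how it is done; let us mention only that an ultimate aim is to cancel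
divergencies."*; p. 432 [PDF 22]: *"Finally for an arbitrary graph G we form a class G_ren containing this graph adding all graphs
necessary to renormalize all divergent proper subgraphs. Of course localizations in these graphs should be in agreement."*; p. 419
[PDF 9]: *"we will consider external fields in the form of functions Φ_ext(x, x′, x″, …), A_ext(y, y′, y″, …) of many variables instead
of a product."*; p. 424 [PDF 14], Prop. 2.1: *"Then we define G_ren = {G}"*.

READING (declared).  r15's `Expansion` is an ABSTRACT carrier (types `RenClass`, `Loc G`, `ExtS`, `ExtV`, the map `E`, the orders,
the tree length, the norms); an instance says what these are for the (Higgs)₂,₃ expansion of Sect. 1 as typed by this lineage: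
a renormalized class (`RClass`) = finitely many MEMBERS (`Member`: a graph of p18's family with its counterterm labels, (1.18) output
pairing, line kernels, coefficient, and enumerations of its external φ′-legs / A′-legs / unpaired outputs), a common localization type
with the vertex localizations it induces on each member (p. 432: *"localizations in these graphs should be in agreement"* — the
agreement is whatever the class designer's `locOf` maps express), the common orders as fields WITH PROOFS `dsOf … = ds` for every
member (print's *"all graphs in the family G_ren have the same orders"*), the tree length supplied; external fields (`ExtScalar`,
`ExtVector`) = for every arity a joint component function (p. 419), the (1.12) block legs separately; `E` of a class := `RClass.amp` =
`Σ_i c_i · graphAmp G_i …` read through the enumerations; the norms (1.32) and their localizing functions `h` are SUPPLIED (`Norms`),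
as in r15's carrier.  Then `expansionOf M … cls nr : Expansion`, and r15's `Ineq133At` at a class of it IS (`Iff.rfl`) the printed
(1.33) for the evaluator's class sum (`ineq133At_expansionOf_iff`).

WHAT IS TYPED / PROVED (definitions with bodies + theorems; no `Prop` fact, no `sorry`; standard axioms).  §1 `ExtScalar`, `ExtVector`;
§2 `Member` (v1.1: + the reading map `σS` of its external φ′-legs, default `id`; `relocate`/`relocate_apply` = the p. 417 counterterm
relocation *"both external legs localized in x"*), **`Member.amp`**, `RClass`, **`RClass.amp`**, `Norms`; §3 **`expansionOf`** (the instance), **`expansionOf_E`** (rfl: its `E`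
is the evaluator's class expression), `expansionOf_ds` / `expansionOf_dv` (= r15's `dsOf` / `dvOf` of every member), **`ineq133At_expansionOf_iff`**
((1.33) for the instance, unfolded); §4 `RClass.single` (the class {G} of Prop. 2.1), `RClass.single_amp`, **`RClass.single_partition_sum`**
(p. 420's localization sum at class level: for partition families of vertex localizations the localized class expressions sum to the
unlocalized one — FILE 2's `graphAmp_partition_sum`).
VERSION.  v1.0 = p363747 (2026-08-23); v1.1 (same seat, same day, no dependents yet): `Member` gains the field `σS` (default `id`) and
`Member.amp` reads the external scalar field through it, so that print's COUNTERTERM members (p. 417: the same graph with both external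
legs localized in x; (3.7)₁ of p. 435) are members of an `RClass`; `relocate` added; nothing else changed.
HONEST SCOPE.  (a) Packaging + unfolding: the mathematics is in FILEs 1–2; this file fixes WHICH objects r15's abstract fields denote
for this lineage's typing and proves only definitional identifications and the class-level localization sum.  (b) The Hölder norms
(1.32) with their localizing functions, the tree length, the line kernels, the list of classes and their coefficients are PARAMETERS
(other seats' objects: p35/p40's norms, p18/p33's classes); nothing about them is claimed.  (c) `B3Prop1.GraphExpansion` (the subgraph
/ degree data of Prop. 2.1) is not instantiated here.  (d) No estimate: (1.33) is unfolded, not proved.  Unit `lit-balaban-p26` gen 40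
(literature-prover-lit-balaban-p26-g40-0), HOME `run/shared/lean/pub/lit-balaban/`, 2026-08-23.
-/

open Finset
open scoped BigOperators

namespace Literature.MathematicalPhysics.QuantumFieldTheory.Balaban1983to89.B3ExpansionFromFeynmanRules

open Literature.MathematicalPhysics.QuantumFieldTheory.Balaban1983to89.B3Prop1
open Literature.MathematicalPhysics.QuantumFieldTheory.Balaban1983to89.B3Cor23Concrete (Graph)
open Literature.MathematicalPhysics.QuantumFieldTheory.Balaban1983to89.B3GraphAmplitude
open Literature.MathematicalPhysics.QuantumFieldTheory.Balaban1983to89.B3GraphAmplitudeRules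

noncomputable section

variable {P : HiggsLattice.Params} {N k nbar : ℕ}

/-! ## §1 External fields as functions of many variables (p. 419) -/

/-- **External scalar fields** Φ_ext (p. 419: *"functions Φ_ext(x, x′, x″, …) … of many variables instead of a product"*): for every
number `m` of external φ′-legs a joint component function of `m` fine-lattice indices `(x, a)`, and for every number of unpaired
averaging outputs a joint component function of block-lattice indices `(y, a)` (the external field (1.12) `φ(y)` they are multiplied
with, (1.18)). [cite: Balaban1983Higgs3, p.419] -/
structure ExtScalar (P : HiggsLattice.Params) (N k : ℕ) where
  /-- joint components of the external fields in `m` φ′-legs. -/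
  fine : (m : ℕ) → (Fin m → HiggsLattice.Site P 0 × Fin N) → ℝ
  /-- joint components of the external field (1.12) in `m` unpaired averaging outputs (with the coefficient of (1.18)). -/
  block : (m : ℕ) → (Fin m → HiggsLattice.Site P k × Fin N) → ℝ

/-- **External vector fields** A_ext (p. 419: *"A_ext(y, y′, y″, …)"*): for every number `m` of external A′-legs a joint function of
`m` bonds. [cite: Balaban1983Higgs3, p.419] -/
def ExtVector (P : HiggsLattice.Params) : Type := (m : ℕ) → (Fin m → HiggsLattice.PBond P 0) → ℝ

/-! ## §2 Members of a renormalized class and their expressions -/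

/-- **A member of a renormalized class G_ren**: a graph of p18's family with its counterterm labels (for its (1.7) vertices), its
(1.18) output pairing, the kernels of its lines (entries of `G_k(Ω,B̃)` / of a (2.6) piece, of the vector covariance, of the (1.18)
pairing), its coefficient in the class (p. 417: `δm²` pieces enter with signs; (3.7): *"(−1)"*), and enumerations of its external
φ′-legs, external A′-legs and unpaired outputs (by which the joint external fields are read), and (v1.1) the way its external
φ′-legs read the external field (`σS`: the identity, or the p. 417 relocation for counterterm members). [cite: Balaban1983Higgs3, p.420]
[cite: Balaban1983Higgs3, p.417] -/
structure Member (P : HiggsLattice.Params) (N k nbar : ℕ) where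
  /-- the coefficient of the member in the class. -/
  coeff : ℝ
  /-- the graph (p18's model). -/
  G : Graph nbar
  /-- the counterterm `δm_i²` carried by each vertex (used by the (1.7) vertices only). -/
  dm2 : Fin G.nV → HiggsLattice.Site P 0 → ℝ
  /-- the (1.18) pairing of the averaging outputs. -/
  Po : OutPairing G
  /-- the kernel of each φ′-line. -/
  Ks : SLine G → HiggsLattice.Site P 0 × Fin N → HiggsLattice.Site P 0 × Fin N → ℝ
  /-- the kernel of each A′-line. -/
  Kv : VLine G → HiggsLattice.PBond P 0 → HiggsLattice.PBond P 0 → ℝ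
  /-- the kernel of each (1.18) output pair. -/
  Ko : Po.Line oRank → HiggsLattice.Site P k × Fin N → HiggsLattice.Site P k × Fin N → ℝ
  /-- number of external φ′-legs. -/
  mS : ℕ
  /-- enumeration of the external φ′-legs. -/
  eS : ExtSLeg G ≃ Fin mS
  /-- number of external A′-legs. -/
  mV : ℕ
  /-- enumeration of the external A′-legs. -/
  eV : ExtVLeg G ≃ Fin mV
  /-- number of unpaired averaging outputs. -/
  mO : ℕ
  /-- enumeration of the unpaired outputs. -/
  eO : Po.Ext ≃ Fin mO
  /-- (v1.1) how the member READS the external scalar field at its external φ′-legs: the identity for a graph of the expansion;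
  for a COUNTERTERM member the relocation of p. 417 — *"If a graph G representing Σ^ε_G(x − x′) has the external legs localized
  in x, x′, then δm²_G = Σ_{x′∈T_ε} ε^d Σ^ε_G(x − x′) will be represented by the same graph G but with both external legs localized
  in x and with the summation over x′"* — e.g. `relocate e e′` (leg `e′` read at the site of leg `e`). -/
  σS : (ExtSLeg G → HiggsLattice.Site P 0 × Fin N) → (ExtSLeg G → HiggsLattice.Site P 0 × Fin N) := id

/-- **The p. 417 relocation of an external leg** (v1.1): leg `e′` is read at the SITE of leg `e`, keeping its own internal index —
*"the same graph G but with both external legs localized in x and with the summation over x′"* (the counterterm member of a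
self-energy graph; cf. `B3Eq37Pictures.pic37a`, whose `loc` sends the leg of the second vertex to the first).
[cite: Balaban1983Higgs3, p.417] -/
def relocate {G : Graph nbar} (e e' : ExtSLeg G) (γ : ExtSLeg G → HiggsLattice.Site P 0 × Fin N) :
    ExtSLeg G → HiggsLattice.Site P 0 × Fin N :=
  fun ℓ => if ℓ = e' then ((γ e).1, (γ e').2) else γ ℓ

/-- The relocated leg sits at the site of `e` with its own index; the other legs are untouched. [cite: Balaban1983Higgs3, p.417] -/
theorem relocate_apply {G : Graph nbar} (e e' : ExtSLeg G) (γ : ExtSLeg G → HiggsLattice.Site P 0 × Fin N) (ℓ : ExtSLeg G) :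
    relocate e e' γ ℓ = if ℓ = e' then ((γ e).1, (γ e').2) else γ ℓ := rfl

variable [DecidableEq (HiggsLattice.PBond P 0)]

/-- **E(G, {□(v)}, Φ_ext, A_ext) of a member**: FILE 2's `graphAmp` of its graph for the model data, at the localization `loc`, with
the joint external fields read through the member's leg enumerations (the scalar one after the member's reading map `σS`, v1.1).
[cite: Balaban1983Higgs3, p.420] -/
def Member.amp (M : Model P N k) (m : Member P N k nbar) (loc : Fin m.G.nV → Loc P k) (Φ : ExtScalar P N k)
    (A : ExtVector P) : ℝ :=
  graphAmp m.G M m.dm2 loc m.Po m.Ks m.Kv m.Ko (fun γ => Φ.fine m.mS (m.σS γ ∘ m.eS.symm)) (fun ζ => A m.mV (ζ ∘ m.eV.symm))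
    (fun ο => Φ.block m.mO (ο ∘ m.eO.symm))

omit [DecidableEq (HiggsLattice.PBond P 0)] in
/-- **A renormalized class G_ren** (p. 420: *"We gather some graphs into families denoted G_ren"*; p. 432: *"Of course localizations
in these graphs should be in agreement"*): finitely many members,
a common localization type with, for every member, the localization it induces on the member's vertices, the common orders
`d_s(G_ren)`, `d_v(G_ren)` (*"all graphs in the family G_ren have the same orders"*, p. 420 — a FIELD WITH PROOF against r15's
`dsOf`/`dvOf`), and the tree length `d({□(v)}_{v∈G_ren})` of the localization (*"a length of a shortest tree graph connecting the
vertices v localized in □(v)"*, p. 421; supplied). [cite: Balaban1983Higgs3, p.420] -/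
structure RClass (P : HiggsLattice.Params) (N k nbar : ℕ) where
  /-- number of members. -/
  n : ℕ
  /-- the members. -/
  member : Fin n → Member P N k nbar
  /-- the localizations {□(v)}_{v∈G_ren} of the class (in agreement across the members). -/
  LocT : Type
  /-- the localization of the vertices of each member induced by a localization of the class. -/
  locOf : (i : Fin n) → LocT → Fin (member i).G.nV → Loc P k
  /-- d_s(G_ren). -/
  ds : ℕ
  /-- d_v(G_ren). -/
  dv : ℕ
  /-- "all graphs in the family G_ren have the same orders": d_s. -/
  ds_eq : ∀ i, dsOf univ (member i).G.kind = ds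
  /-- … d_v. -/
  dv_eq : ∀ i, dvOf univ (member i).G.kind = dv
  /-- d({□(v)}_{v∈G_ren}). -/
  treeLen : LocT → ℝ
  /-- a length is non-negative. -/
  treeLen_nonneg : ∀ l, 0 ≤ treeLen l

/-- **E(G_ren, {□(v)}_{v∈G_ren}, Φ_ext, A_ext)** (p. 420: *"The same symbol with G_ren instead of G denotes a sum of these expressions
for G ∈ G_ren"*; with the members' coefficients): `Σ_i c_i · E(G_i, {□(v)}, Φ_ext, A_ext)`. [cite: Balaban1983Higgs3, p.420] -/
def RClass.amp (M : Model P N k) (C : RClass P N k nbar) (l : C.LocT) (Φ : ExtScalar P N k) (A : ExtVector P) : ℝ :=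
  ∑ i : Fin C.n, (C.member i).coeff * (C.member i).amp M (C.locOf i l) Φ A

omit [DecidableEq (HiggsLattice.PBond P 0)] in
/-- **The norms (1.32) of the localized external fields**, `α ↦ ‖hΦ_ext‖_{1,α}`, `α ↦ ‖h′A_ext‖_{1,α}` (with the localizing functions `h`
of the class's localization, p. 421) — SUPPLIED per class and localization (the Hölder norms (1.32) are other seats' objects; only
their non-negativity is recorded, as in r15's carrier). [cite: Balaban1983Higgs3, (1.32) p.420] -/
structure Norms {𝒞 : Type} (cls : 𝒞 → RClass P N k nbar) where
  /-- `‖hΦ_ext‖_{1,α}`. -/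
  normS : ℝ → (c : 𝒞) → (cls c).LocT → ExtScalar P N k → ℝ
  /-- `‖h′A_ext‖_{1,α}`. -/
  normV : ℝ → (c : 𝒞) → (cls c).LocT → ExtVector P → ℝ
  /-- norms are non-negative. -/
  normS_nonneg : ∀ α c l Φ, 0 ≤ normS α c l Φ
  /-- norms are non-negative. -/
  normV_nonneg : ∀ α c l A, 0 ≤ normV α c l A

/-! ## §3 The instance of r15's carrier `B3Prop1.Expansion` -/

/-- **The perturbation expansion of Sect. 1 for ONE datum as an inhabitant of r15's carrier `B3Prop1.Expansion`, with the field `E`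
GIVEN BY THE FEYNMAN-RULE EVALUATOR**: `E(G_ren, {□(v)}, Φ_ext, A_ext) := Σ_{G∈G_ren} c_G · graphAmp G …` (FILE 1's `amp` at FILE 2's
catalogue rules for the model data `M`), `eRun = e(L^kε)` and `λ(L^kε)` from `M`, `d_s`, `d_v` the classes' common orders (r15's
`dsOf`/`dvOf` of every member), the tree length and the norms (1.32) supplied.  The renormalized classes of the expansion are indexed by
a type `𝒞` of the caller's choice (`cls : 𝒞 → RClass`). [cite: Balaban1983Higgs3, (1.33) p.420] [cite: Balaban1983Higgs3, p.420] -/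
def expansionOf (M : Model P N k) (he : 0 < M.C.e) (hlam : 0 < M.lamRun) {𝒞 : Type} (cls : 𝒞 → RClass P N k nbar)
    (nr : Norms cls) : Expansion where
  eRun := M.C.e
  lamRun := M.lamRun
  eRun_pos := he
  lamRun_pos := hlam
  RenClass := 𝒞
  Loc := fun c => (cls c).LocT
  ExtS := ExtScalar P N k
  ExtV := ExtVector P
  E := fun c l Φ A => (cls c).amp M l Φ A
  ds := fun c => (cls c).ds
  dv := fun c => (cls c).dv
  treeLen := fun c l => (cls c).treeLen l
  treeLen_nonneg := fun c l => (cls c).treeLen_nonneg l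
  normS := fun α c l Φ => nr.normS α c l Φ
  normV := fun α c l A => nr.normV α c l A
  normS_nonneg := fun α c l Φ => nr.normS_nonneg α c l Φ
  normV_nonneg := fun α c l A => nr.normV_nonneg α c l A

/-- **The identification**: the `E` field of the instance IS the evaluator's class expression. [cite: Balaban1983Higgs3, p.420] -/
theorem expansionOf_E (M : Model P N k) (he : 0 < M.C.e) (hlam : 0 < M.lamRun) {𝒞 : Type} (cls : 𝒞 → RClass P N k nbar)
    (nr : Norms cls) (c : 𝒞) (l : (cls c).LocT) (Φ : ExtScalar P N k) (A : ExtVector P) :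
    (expansionOf M he hlam cls nr).E c l Φ A = ∑ i : Fin (cls c).n,
      ((cls c).member i).coeff * ((cls c).member i).amp M ((cls c).locOf i l) Φ A :=
  rfl

/-- The orders of the instance are the printed `d_s(G_ren) = Σ_v d_s(v)` of every member (r15's `dsOf`). [cite: Balaban1983Higgs3, p.420] -/
theorem expansionOf_ds (M : Model P N k) (he : 0 < M.C.e) (hlam : 0 < M.lamRun) {𝒞 : Type} (cls : 𝒞 → RClass P N k nbar)
    (nr : Norms cls) (c : 𝒞) (i : Fin (cls c).n) :
    (expansionOf M he hlam cls nr).ds c = dsOf univ ((cls c).member i).G.kind :=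
  ((cls c).ds_eq i).symm

/-- … and `d_v(G_ren) = Σ_v d_v(v)` (r15's `dvOf`). [cite: Balaban1983Higgs3, p.420] -/
theorem expansionOf_dv (M : Model P N k) (he : 0 < M.C.e) (hlam : 0 < M.lamRun) {𝒞 : Type} (cls : 𝒞 → RClass P N k nbar)
    (nr : Norms cls) (c : 𝒞) (i : Fin (cls c).n) :
    (expansionOf M he hlam cls nr).dv c = dvOf univ ((cls c).member i).G.kind :=
  ((cls c).dv_eq i).symm

/-- **(1.33) FOR THE INSTANCE, unfolded**: r15's `Ineq133At` at a class of this expansion is the printed inequality for the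
evaluator's class expression — `|Σ_{G∈G_ren} c_G·graphAmp G …| ≤ O(1) e(L^kε)^{d_v} λ(L^kε)^{d_s} exp(−δ₀ d({□(v)})) ‖hΦ_ext‖_{1,α₀}
‖h′A_ext‖_{1,α₀}` for all localizations and external fields. [cite: Balaban1983Higgs3, (1.33) p.420] -/
theorem ineq133At_expansionOf_iff (M : Model P N k) (he : 0 < M.C.e) (hlam : 0 < M.lamRun) {𝒞 : Type}
    (cls : 𝒞 → RClass P N k nbar) (nr : Norms cls) (c : 𝒞) (α₀ δ₀ C : ℝ) :
    Ineq133At (expansionOf M he hlam cls nr) c α₀ δ₀ C ↔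
      ∀ (l : (cls c).LocT) (Φ : ExtScalar P N k) (A : ExtVector P),
        |(cls c).amp M l Φ A| ≤ C * M.C.e ^ (cls c).dv * M.lamRun ^ (cls c).ds * Real.exp (-(δ₀ * (cls c).treeLen l)) *
          nr.normS α₀ c l Φ * nr.normV α₀ c l A :=
  Iff.rfl

/-! ## §4 The one-member class {G} -/

omit [DecidableEq (HiggsLattice.PBond P 0)] in
/-- **The class {G} of a single graph** (Prop. 2.1: *"Then we define G_ren = {G}"*): one member, the localizations are the
localizations of its vertices, the orders its orders, the tree length supplied. [cite: Balaban1983Higgs3, Prop. 2.1 p.424] -/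
def RClass.single (m : Member P N k nbar) (tl : (Fin m.G.nV → Loc P k) → ℝ) (htl : ∀ l, 0 ≤ tl l) : RClass P N k nbar where
  n := 1
  member := fun _ => m
  LocT := Fin m.G.nV → Loc P k
  locOf := fun _ l => l
  ds := dsOf univ m.G.kind
  dv := dvOf univ m.G.kind
  ds_eq := fun _ => rfl
  dv_eq := fun _ => rfl
  treeLen := tl
  treeLen_nonneg := htl

/-- The expression of the class {G} is the member's coefficient times E(G, {□(v)}, Φ_ext, A_ext). [cite: Balaban1983Higgs3, Prop. 2.1 p.424] -/
theorem RClass.single_amp (M : Model P N k) (m : Member P N k nbar) (tl : (Fin m.G.nV → Loc P k) → ℝ) (htl : ∀ l, 0 ≤ tl l)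
    (l : Fin m.G.nV → Loc P k) (Φ : ExtScalar P N k) (A : ExtVector P) :
    (RClass.single m tl htl).amp M l Φ A = m.coeff * m.amp M l Φ A := by
  unfold RClass.amp
  exact Fin.sum_univ_one _

/-- **The localization sum at class level for {G}**: for partition families of localizations of the vertices (p. 420's three
prescriptions, FILE 2's `Loc.IsPartitionFor`), the localized class expressions sum to the unlocalized one.
[cite: Balaban1983Higgs3, p.420] -/
theorem RClass.single_partition_sum (M : Model P N k) (m : Member P N k nbar) (tl : (Fin m.G.nV → Loc P k) → ℝ)
    (htl : ∀ l, 0 ≤ tl l) {Cx : Fin m.G.nV → Type*} [∀ i, Fintype (Cx i)] (l : (i : Fin m.G.nV) → Cx i → Loc P k)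
    (hl : ∀ i, Loc.IsPartitionFor (m.G.kind i) (l i)) (Φ : ExtScalar P N k) (A : ExtVector P) :
    ∑ c : (i : Fin m.G.nV) → Cx i, (RClass.single m tl htl).amp M (fun i => l i (c i)) Φ A =
      (RClass.single m tl htl).amp M (fun _ => Loc.triv) Φ A := by
  simp only [RClass.single_amp]
  rw [← Finset.mul_sum]
  congr 1
  exact graphAmp_partition_sum m.G M m.dm2 l hl m.Po m.Ks m.Kv m.Ko _ _ _

end

end Literature.MathematicalPhysics.QuantumFieldTheory.Balaban1983to89.B3ExpansionFromFeynmanRules
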